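import Mathlib.FieldTheory.PurelyInseparable.Basic
import Mathlib.FieldTheory.SeparableClosure
import HarnessLib

/-!
# Crux `FrobeniusLadder.FRationalResolution` (stmt-ResolutionOfSingularities-15317), line `redirect`,
# stub `stub_diagonalizableQuotientResolution` — SEPARABLE CAPTURE OF A RESIDUE EXTENSION: a finite separable extension
# `L` of an ALGEBRAIC extension `M` of `K` lies in the compositum of `M` with finitely many `K`-separable elements
# (field heart of step G1 of the Galois route: splitting the residue data `κ(w) ⊋ κ(x) ⊇ K` of a twisted chart point by a
# finite separable — hence, after normal closure, Galois — extension of the GROUND field, even when `κ(x)/K` is inseparable)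

Mathlib has the structural fact `separableClosure.adjoin_eq_of_isAlgebraic` («separable closure commutes with algebraic
base extension»: `M · K^{sep ∩ L} = M^{sep ∩ L}`). This file extracts the finitary consequence the route consumes, inside any
common over-field `Ω` of `L` (e.g. an algebraic closure):

* **`exists_finset_separable_mem_adjoin`** — `K ⊆ M ⊆ L ⊆ Ω`, `M/K` algebraic, `L/M` finite separable ⇒ there is a finite set
  `T ⊆ Ω` of `K`-SEPARABLE elements with `L ⊆ K(M, T)` inside `Ω`; moreover `K(T)/K` is finite and separable.

Honest label: generic field theory (no stub closed by name); the consumer (the ring/scheme form: points of `B ⊗_K K'` over `𝔭`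
and trivial-residue points of the base-changed chart) is NOT in the tree. No definitions, no named facts, no sorry.
[cite: StacksProject, Tag 030M; Tag 09HD]
-/

noncomputable section

-- single-problem summit: the doubled namespace component is forced
set_option linter.dupNamespace false

namespace Summit.ResolutionOfSingularities.ResolutionOfSingularities.Theorems.FRationalResolution.ResidueSeparableCapture

/-- **Separable capture of a residue extension.** Let `K ⊆ M ⊆ L ⊆ Ω` be fields with `M/K` algebraic and `L/M` finite
separable. Then there is a finite set `T ⊆ Ω` of elements SEPARABLE over `K` such that every element of `L` lies in the
subfield `K(M ∪ T)` of `Ω` generated by `M` and `T`; and `K(T)` is a finite separable extension of `K`.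
(`L = M · (K^{sep} ∩ L)` by `separableClosure.adjoin_eq_of_isAlgebraic`; finitely many separable elements suffice because
`[L : M] < ∞`.) [cite: StacksProject, Tag 030M] -/
theorem exists_finset_separable_mem_adjoin (K M L Ω : Type) [Field K] [Field M] [Field L] [Field Ω]
    [Algebra K M] [Algebra M L] [Algebra K L] [IsScalarTower K M L]
    [Algebra K Ω] [Algebra M Ω] [Algebra L Ω] [IsScalarTower K L Ω] [IsScalarTower M L Ω] [IsScalarTower K M Ω]
    [Algebra.IsAlgebraic K M] [FiniteDimensional M L] [Algebra.IsSeparable M L] :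
    ∃ T : Finset Ω, (∀ t ∈ T, IsSeparable K t) ∧
      (∀ x : L, algebraMap L Ω x ∈ IntermediateField.adjoin K (Set.range (algebraMap M Ω) ∪ (T : Set Ω))) ∧
      FiniteDimensional K (IntermediateField.adjoin K (T : Set Ω)) ∧
      Algebra.IsSeparable K (IntermediateField.adjoin K (T : Set Ω)) := by
  classical
  -- `L = M (K^{sep} ∩ L)`
  set S : IntermediateField K L := separableClosure K L with hS
  have h1 : IntermediateField.adjoin M (S : Set L) = ⊤ := by
    rw [hS, separableClosure.adjoin_eq_of_isAlgebraic]
    exact (separableClosure.eq_top_iff M L).mpr inferInstance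
  -- finitely many separable generators
  set b := Module.finBasis M L with hb
  have hbi : ∀ i, ∃ Ti : Finset L, (Ti : Set L) ⊆ (S : Set L) ∧ b i ∈ IntermediateField.adjoin M (Ti : Set L) :=
    fun i => IntermediateField.exists_finset_of_mem_adjoin (by rw [h1]; exact IntermediateField.mem_top)
  choose Ti hTiS hbTi using hbi
  set TL : Finset L := Finset.univ.biUnion Ti with hTL
  have hTLS : (TL : Set L) ⊆ (S : Set L) := by
    intro t ht
    obtain ⟨i, -, hti⟩ := Finset.mem_biUnion.mp (Finset.mem_coe.mp ht)
    exact hTiS i hti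
  have hxTL : ∀ x : L, x ∈ IntermediateField.adjoin M (TL : Set L) := by
    intro x
    rw [← b.sum_repr x]
    refine IntermediateField.sum_mem _ fun i _ => IntermediateField.smul_mem _ ?_
    exact IntermediateField.adjoin.mono M _ _
      (fun t ht => Finset.mem_coe.mpr (Finset.mem_biUnion.mpr ⟨i, Finset.mem_univ _, ht⟩)) (hbTi i)
  -- push to `Ω`
  set f : L →+* Ω := algebraMap L Ω with hf
  refine ⟨TL.image f, ?_, ?_, ?_, ?_⟩
  · intro t ht
    obtain ⟨s, hs, rfl⟩ := Finset.mem_image.mp ht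
    have hsep : IsSeparable K s := mem_separableClosure_iff.mp (hTLS (Finset.mem_coe.mpr hs))
    exact IsSeparable.map (IsScalarTower.toAlgHom K L Ω) (algebraMap L Ω).injective hsep
  · intro x
    have hx : x ∈ (IntermediateField.adjoin M (TL : Set L)).toSubfield := hxTL x
    rw [IntermediateField.adjoin_toSubfield] at hx
    have hfx : f x ∈ (Subfield.closure (Set.range (algebraMap M L) ∪ (TL : Set L))).map f := ⟨x, hx, rfl⟩
    rw [RingHom.map_field_closure, Set.image_union, ← Set.range_comp, Finset.coe_image.symm] at hfx
    have hcomp : (f ∘ algebraMap M L) = algebraMap M Ω := by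
      funext m
      simp [hf, ← IsScalarTower.algebraMap_apply]
    rw [hcomp] at hfx
    show f x ∈ (IntermediateField.adjoin K (Set.range (algebraMap M Ω) ∪ ((TL.image f : Finset Ω) : Set Ω))).toSubfield
    rw [IntermediateField.adjoin_toSubfield]
    exact Subfield.closure_mono Set.subset_union_right hfx
  · haveI : Finite ((TL.image f : Finset Ω) : Set Ω) := Finset.finite_toSet _
    refine IntermediateField.finiteDimensional_adjoin fun t ht => ?_
    obtain ⟨s, hs, rfl⟩ := Finset.mem_image.mp (Finset.mem_coe.mp ht)
    have hsep : IsSeparable K s := mem_separableClosure_iff.mp (hTLS (Finset.mem_coe.mpr hs))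
    exact (IsSeparable.map (IsScalarTower.toAlgHom K L Ω) (algebraMap L Ω).injective hsep).isIntegral
  · refine (IntermediateField.isSeparable_adjoin_iff_isSeparable K Ω).mpr fun t ht => ?_
    obtain ⟨s, hs, rfl⟩ := Finset.mem_image.mp (Finset.mem_coe.mp ht)
    have hsep : IsSeparable K s := mem_separableClosure_iff.mp (hTLS (Finset.mem_coe.mpr hs))
    exact IsSeparable.map (IsScalarTower.toAlgHom K L Ω) (algebraMap L Ω).injective hsep

end Summit.ResolutionOfSingularities.ResolutionOfSingularities.Theorems.FRationalResolution.ResidueSeparableCapture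

end
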